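import Summits.Ventures.Crystal3D.Theorems.StickyWulffConstantCoaxialWallLawQuietSetComparison
import HarnessLib

/-!
# THE CORE / SEAM SPLIT of the joint (A)-summand for an ARBITRARY core `E ⊆ Y` (crux `CoaxialWallLaw`, stmt-Ventures-19481; line `WallLedgerF`,
# skeleton 'CoaxialWallLawCertificates' v7 → v8; generalises `…SeamSplit` from `exactOf Y` to any core)

HONEST FRAMING. Venture `Summits/Ventures/Crystal3D` (cell `crystal3d-full`); DEFINITIONS + a census-free comparison inequality for the crux `CoaxialWallLaw`
(stmt-Ventures-19481, `route-Ventures-StickyWulffConstant`), lane F T5b.  Nothing about the stubs is claimed; F-C1 not moved.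
WHY: the v8 architecture (cf-p1 (ccxxvii); 19481-p2 14:25Z) bounds the seam residual by a CERTIFICATE on the coherent core `D` (the capping closure of the site
balls, `…SeamCoherentSplit.CoherentAt`) with LOWERED pools plus an analytic SEAM term; the comparison `X ↔ D` is this file with `E := D`.  `…SeamSplit` proved
exactly this for `E = exactOf Y`; the proof never used more than `E ⊆ Y`, so here it is for any core:
* `IsCorePairA Y E`, `coreMultA`, `seamCoreMultA`, `coreMultA_add_seamCoreMultA` (`= endMultA Y`);
* `isEndPairA_core_of_corePair` — a core pair of `Y` (reader, end ball, predecessor and every inspected ball in `E`) is an (A)-end pair of `E`, so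
  `coreMultA Y E b ≤ endMultA E b` (`coreMultA_le`);
* `pooledDef_core_le` — `pooledDef E b + def(b) ≤ pooledDef Y b + heal(b)` (`…QuietSetComparison.pooledDef_sdiff_le` with `J = Y ∖ E`);
* **`localSummandA_le_core_add_seam`** — `Σ_A(Y,0) ≤ Σ_{b ∈ E} e_E(b)/(p_E(b) − heal(b) + def(b)) + #{seam-loaded balls within 1}/p₀` whenever the lowered core
  pools are positive and every seam-loaded ball `b` within `1` has `p₀ · seamCoreMultA b ≤ pooledDef Y b`.
WHAT THIS IS NOT: no certificate, no sparsity lemma; F-C1 not moved.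
-/

noncomputable section

namespace Summit.Ventures.Crystal3D.Theorems

namespace TailResidue

open Summit.Ventures.Crystal3D Finset
open scoped InnerProductSpace

section CoreSplit

variable (Y E : Finset (EuclideanSpace ℝ (Fin 3))) (v : WordVersion) (S₁ S₂ : PlateSystem)

/-- **CORE (A)-END PAIR** relative to a core `E ⊆ Y`: an (A)-end pair `(b, q)` of `Y` witnessed by a class whose reader, end ball and every inspected ball of
the window lie in `E`. -/
def IsCorePairA (b q : EuclideanSpace ℝ (Fin 3)) : Prop :=
  q ∈ Y ∧ b ∈ Y ∧ HasTwoPayers Y b ∧ ∃ G : EuclideanSpace ℝ (Fin 3) ≃ₗᵢ[ℝ] EuclideanSpace ℝ (Fin 3), ∃ d : EuclideanSpace ℝ (Fin 3),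
    (S₁.Adm G d ∨ S₂.Adm G d) ∧ q - d ∈ Y ∧ IsEndMove Y v G d q b ∧ q ∈ E ∧ b ∈ E ∧ ∀ x ∈ Y, InspectedAt G q b x → x ∈ E

open scoped Classical in
/-- Multiplicity of `b` through CORE pairs. -/
def coreMultA (b : EuclideanSpace ℝ (Fin 3)) : ℕ := (Y.filter fun q => IsCorePairA Y E v S₁ S₂ b q).card

open scoped Classical in
/-- Multiplicity of `b` through SEAM pairs: (A)-end pairs of `Y` that are not core pairs. -/
def seamCoreMultA (b : EuclideanSpace ℝ (Fin 3)) : ℕ := (Y.filter fun q => IsEndPairA Y v S₁ S₂ b q ∧ ¬ IsCorePairA Y E v S₁ S₂ b q).card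

variable {Y E v S₁ S₂}

/-- A core pair is an (A)-end pair. -/
theorem isEndPairA_of_corePair {b q : EuclideanSpace ℝ (Fin 3)} (h : IsCorePairA Y E v S₁ S₂ b q) : IsEndPairA Y v S₁ S₂ b q := by
  obtain ⟨hq, hb, hpay, G, d, hadm, hqd, hmove, -, -, -⟩ := h
  exact ⟨hq, hb, hpay, G, d, hadm, hqd, hmove⟩

open scoped Classical in
/-- `endMultA = coreMultA + seamCoreMultA`. -/
theorem coreMultA_add_seamCoreMultA (b : EuclideanSpace ℝ (Fin 3)) : coreMultA Y E v S₁ S₂ b + seamCoreMultA Y E v S₁ S₂ b = endMultA Y v S₁ S₂ b := by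
  unfold coreMultA seamCoreMultA endMultA
  rw [← card_union_of_disjoint]
  · congr 1
    ext q
    simp only [mem_union, mem_filter]
    constructor
    · rintro (⟨hq, he⟩ | ⟨hq, hp, -⟩)
      · exact ⟨hq, isEndPairA_of_corePair he⟩
      · exact ⟨hq, hp⟩
    · rintro ⟨hq, hp⟩
      by_cases he : IsCorePairA Y E v S₁ S₂ b q
      · exact Or.inl ⟨hq, he⟩
      · exact Or.inr ⟨hq, hp, he⟩
  · exact disjoint_left.2 fun q h1 h2 => (mem_filter.1 h2).2.2 (mem_filter.1 h1).2

/-! ### Core pairs live on the core -/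

variable (hY : ∀ p ∈ Y, ∀ q ∈ Y, p ≠ q → 1 ≤ dist p q) (hsub : E ⊆ Y) (h₁ : S₁.RT ⊆ fccSlots) (h₂ : S₂.RT ⊆ fccSlots)

include hY hsub h₁ h₂ in
open scoped Classical in
/-- **A core pair of `Y` is an (A)-end pair of the core `E`.** -/
theorem isEndPairA_core_of_corePair {b q : EuclideanSpace ℝ (Fin 3)} (h : IsCorePairA Y E v S₁ S₂ b q) : IsEndPairA E v S₁ S₂ b q := by
  obtain ⟨hq, hb, hpay, G, d, hadm, hqd, hmove, hqE, hbE, hins⟩ := h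
  have hbE' : b ∈ E := hbE
  refine ⟨hqE, hbE', ?_, G, d, hadm, ?_, isEndMove_of_exact hsub hmove hbE' fun x hx hix => hins x hx hix⟩
  · -- two-payer clause
    have hdeg : ∀ y, (E.filter fun q => dist y q = 1).card ≤ (Y.filter fun q => dist y q = 1).card :=
      fun y => card_le_card (fun p hp => by rw [mem_filter] at hp ⊢; exact ⟨hsub hp.1, hp.2⟩)
    rcases hpay with hle | ⟨z₁, hz₁, z₂, hz₂, hne, hd₁, hd₂, hdeg₁, hdeg₂⟩
    · exact Or.inl ((hdeg b).trans hle)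
    · have drop : ∀ {w}, w ∈ Y → w ∉ E → dist b w = 1 → (E.filter fun q => dist b q = 1).card ≤ 11 := by
        intro w hw hwE hd
        have hwmem : w ∈ Y.filter fun q => dist b q = 1 := mem_filter.2 ⟨hw, hd⟩
        have hs : E.filter (fun q => dist b q = 1) ⊆ (Y.filter fun q => dist b q = 1).erase w := by
          intro p hp; rw [mem_filter] at hp
          exact mem_erase.2 ⟨fun h => hwE (h ▸ hp.1), mem_filter.2 ⟨hsub hp.1, hp.2⟩⟩
        have h12 := card_filter_dist_eq_one_le_twelve Y hY b
        have hc := card_le_card hs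
        rw [card_erase_of_mem hwmem] at hc
        omega
      by_cases hE₁ : z₁ ∈ E
      · by_cases hE₂ : z₂ ∈ E
        · exact Or.inr ⟨z₁, hE₁, z₂, hE₂, hne, hd₁, hd₂, (hdeg z₁).trans hdeg₁, (hdeg z₂).trans hdeg₂⟩
        · exact Or.inl (drop hz₂ hE₂ hd₂)
      · exact Or.inl (drop hz₁ hE₁ hd₁)
  · -- the predecessor is inspected, hence exact
    obtain ⟨w₀, hw₀, hdw⟩ : ∃ w₀ ∈ fccSlots, -d = G w₀ := by
      rcases hadm with h | h
      · exact (exists_slots_of_adm h₁ h).2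
      · exact (exists_slots_of_adm h₂ h).2
    refine hins _ hqd ⟨w₀, hw₀, Or.inl ?_⟩
    rw [sub_eq_add_neg, hdw]

include hY hsub h₁ h₂ in
open scoped Classical in
/-- **Core multiplicities are bounded by the (A)-multiplicities of the core.** -/
theorem coreMultA_le (b : EuclideanSpace ℝ (Fin 3)) : coreMultA Y E v S₁ S₂ b ≤ endMultA E v S₁ S₂ b := by
  unfold coreMultA endMultA
  refine card_le_card fun q hq => ?_
  rw [mem_filter] at hq ⊢
  have hp := isEndPairA_core_of_corePair hY hsub h₁ h₂ hq.2
  exact ⟨hp.1, hp⟩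

include hY hsub in
open scoped Classical in
/-- **Pools of the core**: `pooledDef E b + def(b) ≤ pooledDef Y b + heal(b)` (foreign = balls of `Y ∖ E`). -/
theorem pooledDef_core_le (b : EuclideanSpace ℝ (Fin 3)) :
    pooledDef E b +
        ∑ x ∈ (Y \ E).filter (fun x => dist b x ≤ 1 ∧ (Y.filter fun q => dist x q = 1).card ≤ 11),
          ((12 : ℝ) - ((Y.filter fun q => dist x q = 1).card : ℝ)) ≤
      pooledDef Y b + (((E.filter fun y => dist b y ≤ 1) ×ˢ (Y \ E)).filter fun p => dist p.1 p.2 = 1).card := by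
  have hE : Y \ (Y \ E) = E := Finset.sdiff_sdiff_eq_self hsub
  have h := pooledDef_sdiff_le (X := Y) (J := Y \ E) hY sdiff_subset b
  rw [hE] at h
  exact h

/-! ### The split inequality -/

include hY hsub h₁ h₂ in
open scoped Classical in
/-- **THE CORE / SEAM SPLIT.**  For a core `E ⊆ Y`, `heal(b)` = #(exact within `1` of `b`, non-exact) contacts, `def(b)` = deficiency of the non-exact balls
within `1` of `b`: if every lowered pool `p_E(b) − heal(b) + def(b)` at an exact ball within `1` of the payer is positive, and every SEAM end ball `b` within
`1` of the payer has `p₀ · seamCoreMultA b ≤ pooledDef Y b` (`p₀ > 0`), then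
`Σ_A(Y, 0) ≤ Σ_{b ∈ E, |b| ≤ 1} e_E(b) / (p_E(b) − heal(b) + def(b)) + #{b ∈ Y : |b| ≤ 1, seamCoreMultA b > 0} / p₀`. -/
theorem localSummandA_le_core_add_seam {p₀ : ℝ} (hp₀ : 0 < p₀)
    (hposE : ∀ b ∈ E, dist (0 : EuclideanSpace ℝ (Fin 3)) b ≤ 1 →
      0 < pooledDef (E) b - (((((E).filter fun y => dist b y ≤ 1) ×ˢ (Y \ E)).filter fun p => dist p.1 p.2 = 1).card : ℝ) +
        ∑ x ∈ (Y \ E).filter (fun x => dist b x ≤ 1 ∧ (Y.filter fun q => dist x q = 1).card ≤ 11),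
          ((12 : ℝ) - ((Y.filter fun q => dist x q = 1).card : ℝ)))
    (hseam : ∀ b ∈ Y, dist (0 : EuclideanSpace ℝ (Fin 3)) b ≤ 1 → 0 < seamCoreMultA Y E v S₁ S₂ b → p₀ * (seamCoreMultA Y E v S₁ S₂ b : ℝ) ≤ pooledDef Y b) :
    localSummandA v S₁ S₂ Y 0 ≤
      (∑ b ∈ (E).filter (fun b => dist (0 : EuclideanSpace ℝ (Fin 3)) b ≤ 1 ∧ 0 < endMultA (E) v S₁ S₂ b),
        (endMultA (E) v S₁ S₂ b : ℝ) /
          (pooledDef (E) b - (((((E).filter fun y => dist b y ≤ 1) ×ˢ (Y \ E)).filter fun p => dist p.1 p.2 = 1).card : ℝ) +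
            ∑ x ∈ (Y \ E).filter (fun x => dist b x ≤ 1 ∧ (Y.filter fun q => dist x q = 1).card ≤ 11),
              ((12 : ℝ) - ((Y.filter fun q => dist x q = 1).card : ℝ)))) +
      ((Y.filter fun b => dist (0 : EuclideanSpace ℝ (Fin 3)) b ≤ 1 ∧ 0 < seamCoreMultA Y E v S₁ S₂ b).card : ℝ) / p₀ := by
  unfold localSummandA
  have hexle : ∀ b, coreMultA Y E v S₁ S₂ b ≤ endMultA E v S₁ S₂ b := fun b => coreMultA_le hY hsub h₁ h₂ b
  have hpoolle : ∀ b, pooledDef E b +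
      ∑ x ∈ (Y \ E).filter (fun x => dist b x ≤ 1 ∧ (Y.filter fun q => dist x q = 1).card ≤ 11), ((12 : ℝ) - ((Y.filter fun q => dist x q = 1).card : ℝ)) ≤
      pooledDef Y b + (((E.filter fun y => dist b y ≤ 1) ×ˢ (Y \ E)).filter fun p => dist p.1 p.2 = 1).card := fun b => pooledDef_core_le hY hsub b
  set A := Y.filter (fun b => dist (0 : EuclideanSpace ℝ (Fin 3)) b ≤ 1 ∧ 0 < endMultA Y v S₁ S₂ b) with hA
  set AE := E.filter (fun b => dist (0 : EuclideanSpace ℝ (Fin 3)) b ≤ 1 ∧ 0 < endMultA E v S₁ S₂ b) with hAE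
  set AS := Y.filter (fun b => dist (0 : EuclideanSpace ℝ (Fin 3)) b ≤ 1 ∧ 0 < seamCoreMultA Y E v S₁ S₂ b) with hAS
  set D : EuclideanSpace ℝ (Fin 3) → ℝ := fun b =>
    pooledDef E b - ((((E.filter fun y => dist b y ≤ 1) ×ˢ (Y \ E)).filter fun p => dist p.1 p.2 = 1).card : ℝ) +
      ∑ x ∈ (Y \ E).filter (fun x => dist b x ≤ 1 ∧ (Y.filter fun q => dist x q = 1).card ≤ 11), ((12 : ℝ) - ((Y.filter fun q => dist x q = 1).card : ℝ))
    with hD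
  set gE : EuclideanSpace ℝ (Fin 3) → ℝ := fun b => (endMultA E v S₁ S₂ b : ℝ) / D b with hgE
  set fX : EuclideanSpace ℝ (Fin 3) → ℝ := fun b => (coreMultA Y E v S₁ S₂ b : ℝ) / pooledDef Y b with hfX
  set fS : EuclideanSpace ℝ (Fin 3) → ℝ := fun b => (seamCoreMultA Y E v S₁ S₂ b : ℝ) / pooledDef Y b with hfS
  -- pools of loaded balls are positive: the payer `0`… we only need positivity where used; get it from the two hypotheses
  -- termwise split of the summand
  have hsplit : ∀ b ∈ A, (endMultA Y v S₁ S₂ b : ℝ) / pooledDef Y b = fX b + fS b := by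
    intro b _
    simp only [hfX, hfS, ← add_div]
    congr 1
    exact_mod_cast (coreMultA_add_seamCoreMultA (Y := Y) (E := E) (v := v) (S₁ := S₁) (S₂ := S₂) b).symm
  rw [sum_congr rfl hsplit, sum_add_distrib]
  -- exact part
  have hexact : ∑ b ∈ A, fX b ≤ ∑ b ∈ AE, gE b := by
    have key : ∀ b ∈ A, (0 < coreMultA Y E v S₁ S₂ b → b ∈ AE ∧ fX b ≤ gE b) ∧ (coreMultA Y E v S₁ S₂ b = 0 → fX b = 0) := by
      intro b hb
      obtain ⟨hbY, hb1, hepos⟩ := mem_filter.1 hb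
      refine ⟨fun hx => ?_, fun h0 => by simp only [hfX, h0, Nat.cast_zero, zero_div]⟩
      -- `b` is exact (it is the end ball of an exact pair)
      obtain ⟨q, hq⟩ : ∃ q, q ∈ Y.filter fun q => IsCorePairA Y E v S₁ S₂ b q := by
        by_contra hne
        push Not at hne
        have : coreMultA Y E v S₁ S₂ b = 0 := by
          unfold coreMultA; rw [card_eq_zero]; exact eq_empty_of_forall_notMem hne
        omega
      obtain ⟨-, -, -, G, d, -, -, -, -, hbE, -⟩ := (mem_filter.1 hq).2
      have hle := hexle b
      have hp := hpoolle b
      have hDpos : 0 < D b := hposE b hbE hb1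
      have hDle : D b ≤ pooledDef Y b := by simp only [hD]; linarith
      refine ⟨mem_filter.2 ⟨hbE, hb1, lt_of_lt_of_le hx hle⟩, ?_⟩
      have hleR : (coreMultA Y E v S₁ S₂ b : ℝ) ≤ (endMultA E v S₁ S₂ b : ℝ) := by exact_mod_cast hle
      calc fX b = (coreMultA Y E v S₁ S₂ b : ℝ) / pooledDef Y b := rfl
        _ ≤ (endMultA E v S₁ S₂ b : ℝ) / pooledDef Y b := div_le_div_of_nonneg_right hleR (hDpos.le.trans hDle)
        _ ≤ gE b := div_le_div_of_nonneg_left (Nat.cast_nonneg _) hDpos hDle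
    have hgnn : ∀ b ∈ AE, 0 ≤ gE b := fun b hb => div_nonneg (Nat.cast_nonneg _) (hposE b (mem_filter.1 hb).1 (mem_filter.1 hb).2.1).le
    calc ∑ b ∈ A, fX b = ∑ b ∈ A.filter (fun b => 0 < coreMultA Y E v S₁ S₂ b), fX b :=
          (sum_filter_of_ne fun b hb hne => Nat.pos_of_ne_zero fun h0 => hne ((key b hb).2 h0)).symm
      _ ≤ ∑ b ∈ A.filter (fun b => 0 < coreMultA Y E v S₁ S₂ b), gE b :=
          sum_le_sum fun b hb => ((key b (mem_filter.1 hb).1).1 (mem_filter.1 hb).2).2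
      _ ≤ ∑ b ∈ AE, gE b :=
          sum_le_sum_of_subset_of_nonneg (fun b hb => ((key b (mem_filter.1 hb).1).1 (mem_filter.1 hb).2).1) fun b hb _ => hgnn b hb
  -- seam part
  have hseam' : ∑ b ∈ A, fS b ≤ (AS.card : ℝ) / p₀ := by
    have key : ∀ b ∈ A, (0 < seamCoreMultA Y E v S₁ S₂ b → b ∈ AS ∧ fS b ≤ 1 / p₀) ∧ (seamCoreMultA Y E v S₁ S₂ b = 0 → fS b = 0) := by
      intro b hb
      obtain ⟨hbY, hb1, -⟩ := mem_filter.1 hb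
      refine ⟨fun hs => ⟨mem_filter.2 ⟨hbY, hb1, hs⟩, ?_⟩, fun h0 => by simp only [hfS, h0, Nat.cast_zero, zero_div]⟩
      have hle := hseam b hbY hb1 hs
      have hspos : (0 : ℝ) < (seamCoreMultA Y E v S₁ S₂ b : ℝ) := by exact_mod_cast hs
      have hP : 0 < pooledDef Y b := lt_of_lt_of_le (mul_pos hp₀ hspos) hle
      simp only [hfS]
      rw [div_le_div_iff₀ hP hp₀, one_mul, mul_comm]
      exact hle
    calc ∑ b ∈ A, fS b = ∑ b ∈ A.filter (fun b => 0 < seamCoreMultA Y E v S₁ S₂ b), fS b :=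
          (sum_filter_of_ne fun b hb hne => Nat.pos_of_ne_zero fun h0 => hne ((key b hb).2 h0)).symm
      _ ≤ ∑ b ∈ A.filter (fun b => 0 < seamCoreMultA Y E v S₁ S₂ b), 1 / p₀ :=
          sum_le_sum fun b hb => ((key b (mem_filter.1 hb).1).1 (mem_filter.1 hb).2).2
      _ ≤ ∑ b ∈ AS, 1 / p₀ :=
          sum_le_sum_of_subset_of_nonneg (fun b hb => ((key b (mem_filter.1 hb).1).1 (mem_filter.1 hb).2).1) fun _ _ _ => by positivity
      _ = (AS.card : ℝ) / p₀ := by rw [sum_const, nsmul_eq_mul, mul_one_div]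
  linarith

end CoreSplit

end TailResidue

end Summit.Ventures.Crystal3D.Theorems

end
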